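import Mathlib
import HarnessLib
import Summits.HubbardSuperconductivity.HubbardSuperconductivity.Theorems.KLProgrammeKLRegimeSplitGlueP4
import Summits.HubbardSuperconductivity.HubbardSuperconductivity.Theorems.KLProgrammeKLRegimeVolumeLimitExDefs

/-!
# Route `KLProgramme` — the K3-NAMED glue of the five gen-4 children at `klPredsV12` with the ∃-threshold volume-limit slot
# `FinalTwoLegVolLimitEx` (Δ-VL1, plan g11 2026-08-26T23:34:46Z) (stmt-HubbardSuperconductivity-19937; DOWNSTREAM of the route file)

`KLRegimeInductionV12P4Ex := KLRegimeInductionP4 klPredsV12 FinalTwoLegVolLimitEx`.  Nothing else is asserted.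
-/

noncomputable section

namespace Summit.HubbardSuperconductivity.HubbardSuperconductivity.Theorems.KLRegimeSplit

set_option linter.dupNamespace false -- summit = problem name (single-conjunct summit), D-0017

/-- **The K3-named glue at `klPredsV12` with the ∃-slot**: `EngineP4 klPredsV12 klWindowC`, `BetaSplitP klPredsV12 klWindowC`,
`CountertermP2 klPredsV12 klWindowC`, `VolumeLimitP2 klPredsV12 FinalTwoLegVolLimitEx klWindowC`, `TwoPointAssemblyP3 klPredsV12 FinalTwoLegVolLimitEx klWindowC`
imply crux K3 `KLRegimeTwoPointLimit` BY NAME. -/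
theorem KLRegimeInductionV12P4Ex :
    EngineP4 klPredsV12 klWindowC → BetaSplitP klPredsV12 klWindowC → CountertermP2 klPredsV12 klWindowC →
      VolumeLimitP2 klPredsV12 FinalTwoLegVolLimitEx klWindowC → TwoPointAssemblyP3 klPredsV12 FinalTwoLegVolLimitEx klWindowC →
        Summit.HubbardSuperconductivity.HubbardSuperconductivity.Theses.KLProgramme.KLRegimeTwoPointLimit :=
  KLRegimeInductionP4 klPredsV12 FinalTwoLegVolLimitEx

end Summit.HubbardSuperconductivity.HubbardSuperconductivity.Theorems.KLRegimeSplit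

end
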